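import Mathlib
import HarnessLib
import Summits.HubbardSuperconductivity.HubbardSuperconductivity.Theorems.WeakCouplingBCSKlLindhardEnclosureKernel
import Summits.HubbardSuperconductivity.HubbardSuperconductivity.Theorems.WeakCouplingBCSKlLindhardEnclosureCellSound

/-!
# KL-MARGIN-SCAN reader (22) «kernel-lindhard-enclosure» — TIP RULE, records soundness (cell gate-hubbard-kl, seat p4 g25)

Soundness of the integer records the tip rule (`Params.ceilTip`, `…LindhardEnclosureKernel` §3b) computes with, as real inequalities:

* §1 interval arithmetic: `IV.mul_sound`, `IV.sub_sound`, `IV.absLo_sound` (`lo ≤ z ≤ hi ⇒ absLo ≤ |z|`), `IV.absLo_nonneg`,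
  `IV.abs_le_max` (`|z| ≤ max |lo| |hi|`);
* §2 `Params.opDnZ_le`/`Params.le_opUpZ` — `opDnZ c ≤ D(1 + 2t′·c/D) ≤ opUpZ c`; `Params.op_enclosure` — for `cos s ∈ [cLo, cHi]/D`:
  `min (opDnZ cLo) (opDnZ cHi) ≤ D(1 + 2t′cos s) ≤ max (opUpZ cLo) (opUpZ cHi)` (affine in `cos s`);
* §3 **`Params.derivIV_sound`** — with the direction flag of `cos r` (`true`: `sin r ≥ 0`; `false`: `sin r ≤ 0`), checked hints `τ/10⁴ ≤ |sin r| ≤ σ/10⁴`,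
  `cos s ∈ [cLo, cHi]/D` and the two guards: `(derivIV dir τ σ cLo cHi).lo ≤ 10⁴·D·(2 sin r (1 + 2t′cos s)) ≤ (derivIV …).hi`;
* §4 `Params.abs_sub_mu_le_distHiZ` — `e1Lo/D ≤ ε ≤ e1Hi/D ⇒ |ε − μ| ≤ distHiZ e1Lo e1Hi / D`; §5 `Params.scaled_partial_le_Lmax` —
  `10⁴·D·|2 sin r (1 + 2t′cos s)| ≤ 2·10⁴·(D + ⌈2|tpN|D/tpD⌉)`.

Pure records-layer lemmas (no integrals); nothing here asserts `CeilTipSoundOrd`, a χ₀ enclosure, a margin, `K₃`, `U₀`, the window or superconductivity.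
References: idea-4 r11 Core §3b (tree: `…LindhardEnclosureKernel`).
-/

noncomputable section

set_option linter.dupNamespace false

namespace Summit.HubbardSuperconductivity.HubbardSuperconductivity.Theorems.KlLindhardEnclosure

open Real Set

/-! ## §1 Interval arithmetic soundness -/

/-- For `x ∈ [l, h]` and any `t`: `min (l t) (h t) ≤ x t ≤ max (l t) (h t)`. [folklore] -/
theorem mul_mem_of_mem {l h x t : ℝ} (h1 : l ≤ x) (h2 : x ≤ h) : min (l * t) (h * t) ≤ x * t ∧ x * t ≤ max (l * t) (h * t) := by
  rcases le_total 0 t with ht | ht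
  · exact ⟨(min_le_left _ _).trans (mul_le_mul_of_nonneg_right h1 ht), (mul_le_mul_of_nonneg_right h2 ht).trans (le_max_right _ _)⟩
  · exact ⟨(min_le_right _ _).trans (mul_le_mul_of_nonpos_right h2 ht), (mul_le_mul_of_nonpos_right h1 ht).trans (le_max_left _ _)⟩

/-- For `x ∈ [l, h]` and any `t`: `min (t l) (t h) ≤ t x ≤ max (t l) (t h)`. [folklore] -/
theorem mul_mem_of_mem' {l h x t : ℝ} (h1 : l ≤ x) (h2 : x ≤ h) : min (t * l) (t * h) ≤ t * x ∧ t * x ≤ max (t * l) (t * h) := by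
  have := mul_mem_of_mem (t := t) h1 h2
  simpa only [mul_comm] using this

/-- **Interval product is sound**: `x ∈ [a.lo, a.hi]`, `y ∈ [b.lo, b.hi]` ⇒ `x·y ∈ [(a.mul b).lo, (a.mul b).hi]`. [folklore] -/
theorem IV.mul_sound (a b : IV) {x y : ℝ} (hx1 : (a.lo : ℝ) ≤ x) (hx2 : x ≤ (a.hi : ℝ)) (hy1 : (b.lo : ℝ) ≤ y) (hy2 : y ≤ (b.hi : ℝ)) :
    ((a.mul b).lo : ℝ) ≤ x * y ∧ x * y ≤ ((a.mul b).hi : ℝ) := by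
  simp only [IV.mul, Int.cast_min, Int.cast_max, Int.cast_mul]
  obtain ⟨h1, h2⟩ := mul_mem_of_mem (t := y) hx1 hx2
  obtain ⟨l1, l2⟩ := mul_mem_of_mem' (t := (a.lo : ℝ)) hy1 hy2
  obtain ⟨u1, u2⟩ := mul_mem_of_mem' (t := (a.hi : ℝ)) hy1 hy2
  exact ⟨(min_le_min l1 u1).trans h1, h2.trans (max_le_max l2 u2)⟩

/-- **Interval difference is sound.** [folklore] -/
theorem IV.sub_sound (a b : IV) {x y : ℝ} (hx1 : (a.lo : ℝ) ≤ x) (hx2 : x ≤ (a.hi : ℝ)) (hy1 : (b.lo : ℝ) ≤ y) (hy2 : y ≤ (b.hi : ℝ)) :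
    ((a.sub b).lo : ℝ) ≤ x - y ∧ x - y ≤ ((a.sub b).hi : ℝ) := by
  simp only [IV.sub, Int.cast_sub]
  exact ⟨by linarith, by linarith⟩

/-- `absLo ≥ 0`. [folklore] -/
theorem IV.absLo_nonneg (a : IV) : 0 ≤ a.absLo := by
  unfold IV.absLo
  split_ifs <;> omega

/-- **Distance from zero is sound**: `z ∈ [a.lo, a.hi]` ⇒ `absLo a ≤ |z|`. [folklore] -/
theorem IV.absLo_sound (a : IV) {z : ℝ} (h1 : (a.lo : ℝ) ≤ z) (h2 : z ≤ (a.hi : ℝ)) : (a.absLo : ℝ) ≤ |z| := by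
  unfold IV.absLo
  split_ifs with hlo hhi
  · have : (0 : ℝ) < (a.lo : ℝ) := by exact_mod_cast hlo
    rw [abs_of_pos (by linarith)]; exact h1
  · have : (a.hi : ℝ) < 0 := by exact_mod_cast hhi
    rw [abs_of_neg (by linarith), Int.cast_neg]; linarith
  · simp

/-- `z ∈ [a.lo, a.hi]` ⇒ `|z| ≤ max |a.lo| |a.hi|`. [folklore] -/
theorem IV.abs_le_max (a : IV) {z : ℝ} (h1 : (a.lo : ℝ) ≤ z) (h2 : z ≤ (a.hi : ℝ)) : |z| ≤ ((max |a.lo| |a.hi| : ℤ) : ℝ) := by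
  rw [Int.cast_max, Int.cast_abs, Int.cast_abs]
  exact abs_le_max_abs_abs h1 h2

/-! ## §2 The factor `1 + 2t′cos s` -/

/-- `opDnZ c ≤ D·(1 + 2t′·(c/D))` (`tpD > 0`). [folklore] -/
theorem Params.opDnZ_le (P : Params) (htpD : 0 < P.tpD) (c : ℤ) :
    ((P.opDnZ c : ℤ) : ℝ) ≤ (2 : ℝ) ^ 40 * (1 + 2 * ((P.tpN : ℝ) / (P.tpD : ℝ)) * ((c : ℝ) / 2 ^ 40)) := by
  have h := fdivZ_le_div (2 * P.tpN * c) P.tpD htpD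
  have h' : ((fdivZ (2 * P.tpN * c) P.tpD : ℤ) : ℝ) ≤ (2 * (P.tpN : ℝ) * (c : ℝ)) / (P.tpD : ℝ) := by
    have := (Rat.cast_le (K := ℝ)).2 h
    push_cast at this
    exact this
  have htpD' : (0 : ℝ) < (P.tpD : ℝ) := by exact_mod_cast htpD
  simp only [Params.opDnZ, D, Int.cast_add, Int.cast_pow, Int.cast_ofNat]
  have e : (2 : ℝ) ^ 40 * (1 + 2 * ((P.tpN : ℝ) / (P.tpD : ℝ)) * ((c : ℝ) / 2 ^ 40)) = 2 ^ 40 + 2 * (P.tpN : ℝ) * (c : ℝ) / (P.tpD : ℝ) := by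
    field_simp
  rw [e]; linarith

/-- `D·(1 + 2t′·(c/D)) ≤ opUpZ c` (`tpD > 0`). [folklore] -/
theorem Params.le_opUpZ (P : Params) (htpD : 0 < P.tpD) (c : ℤ) :
    (2 : ℝ) ^ 40 * (1 + 2 * ((P.tpN : ℝ) / (P.tpD : ℝ)) * ((c : ℝ) / 2 ^ 40)) ≤ ((P.opUpZ c : ℤ) : ℝ) := by
  have h := div_le_cdivZ (2 * P.tpN * c) P.tpD htpD
  have h' : (2 * (P.tpN : ℝ) * (c : ℝ)) / (P.tpD : ℝ) ≤ ((cdivZ (2 * P.tpN * c) P.tpD : ℤ) : ℝ) := by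
    have := (Rat.cast_le (K := ℝ)).2 h
    push_cast at this
    exact this
  have htpD' : (0 : ℝ) < (P.tpD : ℝ) := by exact_mod_cast htpD
  simp only [Params.opUpZ, D, Int.cast_add, Int.cast_pow, Int.cast_ofNat]
  have e : (2 : ℝ) ^ 40 * (1 + 2 * ((P.tpN : ℝ) / (P.tpD : ℝ)) * ((c : ℝ) / 2 ^ 40)) = 2 ^ 40 + 2 * (P.tpN : ℝ) * (c : ℝ) / (P.tpD : ℝ) := by
    field_simp
  rw [e]; linarith

/-- **Enclosure of `D(1 + 2t′cos s)`** for `cos s ∈ [cLo, cHi]/D` (the factor is affine in `cos s`). [folklore] -/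
theorem Params.op_enclosure (P : Params) (htpD : 0 < P.tpD) {cLo cHi : ℤ} {cs : ℝ} (h1 : ((cLo : ℤ) : ℝ) / 2 ^ 40 ≤ cs)
    (h2 : cs ≤ ((cHi : ℤ) : ℝ) / 2 ^ 40) :
    ((min (P.opDnZ cLo) (P.opDnZ cHi) : ℤ) : ℝ) ≤ (2 : ℝ) ^ 40 * (1 + 2 * ((P.tpN : ℝ) / (P.tpD : ℝ)) * cs) ∧
      (2 : ℝ) ^ 40 * (1 + 2 * ((P.tpN : ℝ) / (P.tpD : ℝ)) * cs) ≤ ((max (P.opUpZ cLo) (P.opUpZ cHi) : ℤ) : ℝ) := by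
  set t : ℝ := (P.tpN : ℝ) / (P.tpD : ℝ)
  have haff : ∀ c : ℝ, (2 : ℝ) ^ 40 * (1 + 2 * t * c) = 2 ^ 40 + (2 ^ 41 * t) * c := fun c => by ring
  have hlo := P.opDnZ_le htpD cLo
  have hhi := P.opDnZ_le htpD cHi
  have ulo := P.le_opUpZ htpD cLo
  have uhi := P.le_opUpZ htpD cHi
  rw [haff] at hlo hhi ulo uhi
  rw [Int.cast_min, Int.cast_max, haff]
  obtain ⟨m1, m2⟩ := mul_mem_of_mem' (t := 2 ^ 41 * t) h1 h2
  constructor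
  · calc min ((P.opDnZ cLo : ℤ) : ℝ) ((P.opDnZ cHi : ℤ) : ℝ)
        ≤ min ((2 : ℝ) ^ 40 + 2 ^ 41 * t * (((cLo : ℤ) : ℝ) / 2 ^ 40)) (2 ^ 40 + 2 ^ 41 * t * (((cHi : ℤ) : ℝ) / 2 ^ 40)) :=
          min_le_min hlo hhi
      _ = 2 ^ 40 + min (2 ^ 41 * t * (((cLo : ℤ) : ℝ) / 2 ^ 40)) (2 ^ 41 * t * (((cHi : ℤ) : ℝ) / 2 ^ 40)) := (min_add_add_left _ _ _)
      _ ≤ 2 ^ 40 + 2 ^ 41 * t * cs := by linarith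
  · calc (2 : ℝ) ^ 40 + 2 ^ 41 * t * cs
        ≤ 2 ^ 40 + max (2 ^ 41 * t * (((cLo : ℤ) : ℝ) / 2 ^ 40)) (2 ^ 41 * t * (((cHi : ℤ) : ℝ) / 2 ^ 40)) := by linarith
      _ = max ((2 : ℝ) ^ 40 + 2 ^ 41 * t * (((cLo : ℤ) : ℝ) / 2 ^ 40)) (2 ^ 40 + 2 ^ 41 * t * (((cHi : ℤ) : ℝ) / 2 ^ 40)) :=
          (max_add_add_left _ _ _).symm
      _ ≤ max ((P.opUpZ cLo : ℤ) : ℝ) ((P.opUpZ cHi : ℤ) : ℝ) := max_le_max ulo uhi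

/-! ## §3 The derivative interval `derivIV` -/

/-- **`derivIV` is sound.**  Let `dir` be the certified direction of `cos r` on the window (`true`: `sin r ≥ 0`; `false`: `sin r ≤ 0`),
`τ/10⁴ ≤ |sin r| ≤ σ/10⁴` the checked sine hints, `cos s ∈ [cLo, cHi]/D`, and `0 ≤ 1 + 2t′cos s` (the guards).  Then the scaled partial
`10⁴·D·(2 sin r (1 + 2t′cos s))` lies in `[(derivIV dir τ σ cLo cHi).lo, (derivIV …).hi]`. [folklore] -/
theorem Params.derivIV_sound (P : Params) (htpD : 0 < P.tpD) {dir : Bool} {τ σ : ℕ} {cLo cHi : ℤ} {r s : ℝ}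
    (hdirT : dir = true → 0 ≤ Real.sin r) (hdirF : dir = false → Real.sin r ≤ 0)
    (hτ : (τ : ℝ) / 10 ^ 4 ≤ |Real.sin r|) (hσ : |Real.sin r| ≤ (σ : ℝ) / 10 ^ 4)
    (hc1 : ((cLo : ℤ) : ℝ) / 2 ^ 40 ≤ Real.cos s) (hc2 : Real.cos s ≤ ((cHi : ℤ) : ℝ) / 2 ^ 40)
    (hop : 0 ≤ 1 + 2 * ((P.tpN : ℝ) / (P.tpD : ℝ)) * Real.cos s) :
    (((P.derivIV dir τ σ cLo cHi).lo : ℤ) : ℝ) ≤ 10 ^ 4 * 2 ^ 40 * (2 * Real.sin r * (1 + 2 * ((P.tpN : ℝ) / (P.tpD : ℝ)) * Real.cos s)) ∧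
      10 ^ 4 * 2 ^ 40 * (2 * Real.sin r * (1 + 2 * ((P.tpN : ℝ) / (P.tpD : ℝ)) * Real.cos s)) ≤ (((P.derivIV dir τ σ cLo cHi).hi : ℤ) : ℝ) := by
  obtain ⟨hO1, hO2⟩ := P.op_enclosure htpD hc1 hc2
  set O : ℝ := (2 : ℝ) ^ 40 * (1 + 2 * ((P.tpN : ℝ) / (P.tpD : ℝ)) * Real.cos s) with hOdef
  have hO0 : 0 ≤ O := by rw [hOdef]; positivity
  set S : ℝ := 10 ^ 4 * Real.sin r with hSdef
  have hval : (10 : ℝ) ^ 4 * 2 ^ 40 * (2 * Real.sin r * (1 + 2 * ((P.tpN : ℝ) / (P.tpD : ℝ)) * Real.cos s)) = 2 * S * O := by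
    rw [hSdef, hOdef]; ring
  rw [hval]
  have hτ0 : (0 : ℝ) ≤ (τ : ℝ) := Nat.cast_nonneg τ
  have hσ0 : (0 : ℝ) ≤ (σ : ℝ) := Nat.cast_nonneg σ
  set opLo : ℤ := min (P.opDnZ cLo) (P.opDnZ cHi) with hopLo
  set opHi : ℤ := max (P.opUpZ cLo) (P.opUpZ cHi) with hopHi
  cases dir with
  | true =>
    have hs : 0 ≤ Real.sin r := hdirT rfl
    have hSlo : (τ : ℝ) ≤ S := by rw [abs_of_nonneg hs] at hτ; rw [hSdef]; linarith [(div_le_iff₀ (by norm_num : (0:ℝ) < 10 ^ 4)).1 hτ]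
    have hShi : S ≤ (σ : ℝ) := by rw [abs_of_nonneg hs] at hσ; rw [hSdef]; linarith [(le_div_iff₀ (by norm_num : (0:ℝ) < 10 ^ 4)).1 hσ]
    have hS0 : 0 ≤ S := le_trans hτ0 hSlo
    simp only [Params.derivIV, ↓reduceIte, Int.cast_mul, Int.cast_ofNat, Int.cast_natCast]
    rw [← hopLo, ← hopHi]
    constructor
    · -- 2 τ opLo ≤ 2 S O
      have h1 : (τ : ℝ) * (opLo : ℝ) ≤ (τ : ℝ) * O := mul_le_mul_of_nonneg_left hO1 hτ0
      have h2 : (τ : ℝ) * O ≤ S * O := mul_le_mul_of_nonneg_right hSlo hO0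
      linarith
    · have h1 : S * O ≤ (σ : ℝ) * O := mul_le_mul_of_nonneg_right hShi hO0
      have h2 : (σ : ℝ) * O ≤ (σ : ℝ) * (opHi : ℝ) := mul_le_mul_of_nonneg_left hO2 hσ0
      linarith
  | false =>
    have hs : Real.sin r ≤ 0 := hdirF rfl
    have hSlo : S ≤ -(τ : ℝ) := by rw [abs_of_nonpos hs] at hτ; rw [hSdef]; linarith [(div_le_iff₀ (by norm_num : (0:ℝ) < 10 ^ 4)).1 hτ]
    have hShi : -(σ : ℝ) ≤ S := by rw [abs_of_nonpos hs] at hσ; rw [hSdef]; linarith [(le_div_iff₀ (by norm_num : (0:ℝ) < 10 ^ 4)).1 hσ]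
    simp only [Params.derivIV, Bool.false_eq_true, ↓reduceIte, Int.cast_neg, Int.cast_mul, Int.cast_ofNat, Int.cast_natCast]
    rw [← hopLo, ← hopHi]
    constructor
    · -- -(2 σ opHi) ≤ 2 S O
      have h1 : -(σ : ℝ) * O ≤ S * O := mul_le_mul_of_nonneg_right hShi hO0
      have h2 : (σ : ℝ) * O ≤ (σ : ℝ) * (opHi : ℝ) := mul_le_mul_of_nonneg_left hO2 hσ0
      nlinarith
    · have h1 : S * O ≤ -(τ : ℝ) * O := mul_le_mul_of_nonneg_right hSlo hO0
      have h2 : (τ : ℝ) * (opLo : ℝ) ≤ (τ : ℝ) * O := mul_le_mul_of_nonneg_left hO1 hτ0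
      nlinarith

/-! ## §4 The energy excursion `distHiZ` -/

/-- `(D : ℝ) = 2^40`. [folklore] -/
theorem cast_D_real : ((D : ℤ) : ℝ) = 2 ^ 40 := by norm_num [D]

/-- `fdivZ a b ≤ a/b ≤ cdivZ a b` over `ℝ` (`b > 0`). [folklore] -/
theorem fdivZ_le_div_real (a b : ℤ) (hb : 0 < b) : ((fdivZ a b : ℤ) : ℝ) ≤ (a : ℝ) / (b : ℝ) := by
  have h := (Rat.cast_le (K := ℝ)).2 (fdivZ_le_div a b hb)
  rw [Rat.cast_div, Rat.cast_intCast, Rat.cast_intCast, Rat.cast_intCast] at h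
  exact h

/-- `a/b ≤ cdivZ a b` over `ℝ` (`b > 0`). [folklore] -/
theorem div_le_cdivZ_real (a b : ℤ) (hb : 0 < b) : (a : ℝ) / (b : ℝ) ≤ ((cdivZ a b : ℤ) : ℝ) := by
  have h := (Rat.cast_le (K := ℝ)).2 (div_le_cdivZ a b hb)
  rw [Rat.cast_div, Rat.cast_intCast, Rat.cast_intCast, Rat.cast_intCast] at h
  exact h

/-- `muFl ≤ D·μ ≤ muCl` (`muD > 0`). [folklore] -/
theorem Params.muFl_le_le_muCl (P : Params) (hmuD : 0 < P.muD) :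
    ((P.muFl : ℤ) : ℝ) ≤ (2 : ℝ) ^ 40 * ((P.muN : ℝ) / (P.muD : ℝ)) ∧ (2 : ℝ) ^ 40 * ((P.muN : ℝ) / (P.muD : ℝ)) ≤ ((P.muCl : ℤ) : ℝ) := by
  have hmuD' : (0 : ℝ) < (P.muD : ℝ) := by exact_mod_cast hmuD
  have h1 := fdivZ_le_div_real (P.muN * D) P.muD hmuD
  have h2 := div_le_cdivZ_real (P.muN * D) P.muD hmuD
  rw [Int.cast_mul, cast_D_real] at h1 h2
  have e : (P.muN : ℝ) * 2 ^ 40 / (P.muD : ℝ) = 2 ^ 40 * ((P.muN : ℝ) / (P.muD : ℝ)) := by ring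
  rw [e] at h1 h2
  exact ⟨h1, h2⟩

/-- **`distHiZ` bounds the excursion**: `eLo/D ≤ ε ≤ eHi/D ⇒ |ε − μ| ≤ distHiZ eLo eHi / D`. [folklore] -/
theorem Params.abs_sub_mu_le_distHiZ (P : Params) (hmuD : 0 < P.muD) {eLo eHi : ℤ} {e : ℝ} (h1 : ((eLo : ℤ) : ℝ) / 2 ^ 40 ≤ e)
    (h2 : e ≤ ((eHi : ℤ) : ℝ) / 2 ^ 40) :
    |e - (P.muN : ℝ) / (P.muD : ℝ)| ≤ ((P.distHiZ eLo eHi : ℤ) : ℝ) / 2 ^ 40 := by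
  obtain ⟨m1, m2⟩ := P.muFl_le_le_muCl hmuD
  have h1' : ((eLo : ℤ) : ℝ) ≤ e * 2 ^ 40 := by rwa [div_le_iff₀ (by positivity)] at h1
  have h2' : e * 2 ^ 40 ≤ ((eHi : ℤ) : ℝ) := by rwa [le_div_iff₀ (by positivity)] at h2
  simp only [Params.distHiZ, Int.cast_max, Int.cast_sub]
  have hM1 : ((eHi : ℤ) : ℝ) - ((P.muFl : ℤ) : ℝ) ≤ max (((eHi : ℤ) : ℝ) - ((P.muFl : ℤ) : ℝ)) (((P.muCl : ℤ) : ℝ) - ((eLo : ℤ) : ℝ)) :=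
    le_max_left _ _
  have hM2 : ((P.muCl : ℤ) : ℝ) - ((eLo : ℤ) : ℝ) ≤ max (((eHi : ℤ) : ℝ) - ((P.muFl : ℤ) : ℝ)) (((P.muCl : ℤ) : ℝ) - ((eLo : ℤ) : ℝ)) :=
    le_max_right _ _
  rw [abs_sub_le_iff, le_div_iff₀ (by positivity), le_div_iff₀ (by positivity)]
  constructor
  · nlinarith
  · nlinarith

/-! ## §5 The uniform bound `Lmax` on the scaled partials -/

/-- **`Lmax` dominates every scaled partial**: `10⁴·D·|2 sin r (1 + 2t′cos s)| ≤ 2·10⁴·(D + ⌈2|tpN|D/tpD⌉)` (`tpD > 0`). [folklore] -/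
theorem Params.scaled_partial_le_Lmax (P : Params) (htpD : 0 < P.tpD) (r s : ℝ) :
    (10 : ℝ) ^ 4 * 2 ^ 40 * |2 * Real.sin r * (1 + 2 * ((P.tpN : ℝ) / (P.tpD : ℝ)) * Real.cos s)| ≤
      ((2 * 10 ^ 4 * (D + cdivZ (2 * |P.tpN| * D) P.tpD) : ℤ) : ℝ) := by
  have htpD' : (0 : ℝ) < (P.tpD : ℝ) := by exact_mod_cast htpD
  have hc := div_le_cdivZ_real (2 * |P.tpN| * D) P.tpD htpD
  rw [Int.cast_mul, Int.cast_mul, Int.cast_abs, cast_D_real, Int.cast_ofNat] at hc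
  have hs := Real.abs_sin_le_one r
  have hcs := Real.abs_cos_le_one s
  have habs : |2 * Real.sin r * (1 + 2 * ((P.tpN : ℝ) / (P.tpD : ℝ)) * Real.cos s)| ≤ 2 * (1 + 2 * (|(P.tpN : ℝ)| / (P.tpD : ℝ))) := by
    rw [abs_mul, abs_mul, abs_two]
    have h1 : |1 + 2 * ((P.tpN : ℝ) / (P.tpD : ℝ)) * Real.cos s| ≤ 1 + 2 * (|(P.tpN : ℝ)| / (P.tpD : ℝ)) := by
      calc |1 + 2 * ((P.tpN : ℝ) / (P.tpD : ℝ)) * Real.cos s| ≤ |(1 : ℝ)| + |2 * ((P.tpN : ℝ) / (P.tpD : ℝ)) * Real.cos s| := abs_add_le _ _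
        _ = 1 + 2 * (|(P.tpN : ℝ)| / (P.tpD : ℝ)) * |Real.cos s| := by
            rw [abs_one, abs_mul, abs_mul, abs_two, abs_div, abs_of_pos htpD']
        _ ≤ 1 + 2 * (|(P.tpN : ℝ)| / (P.tpD : ℝ)) * 1 := by gcongr
        _ = 1 + 2 * (|(P.tpN : ℝ)| / (P.tpD : ℝ)) := by ring
    calc 2 * |Real.sin r| * |1 + 2 * ((P.tpN : ℝ) / (P.tpD : ℝ)) * Real.cos s| ≤ 2 * 1 * (1 + 2 * (|(P.tpN : ℝ)| / (P.tpD : ℝ))) := by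
          gcongr
      _ = 2 * (1 + 2 * (|(P.tpN : ℝ)| / (P.tpD : ℝ))) := by ring
  have e : (((2 * 10 ^ 4 * (D + cdivZ (2 * |P.tpN| * D) P.tpD)) : ℤ) : ℝ) = 2 * 10 ^ 4 * (2 ^ 40 + ((cdivZ (2 * |P.tpN| * D) P.tpD : ℤ) : ℝ)) := by
    push_cast
    rw [cast_D_real]
    norm_num
  rw [e]
  calc (10 : ℝ) ^ 4 * 2 ^ 40 * |2 * Real.sin r * (1 + 2 * ((P.tpN : ℝ) / (P.tpD : ℝ)) * Real.cos s)|
      ≤ 10 ^ 4 * 2 ^ 40 * (2 * (1 + 2 * (|(P.tpN : ℝ)| / (P.tpD : ℝ)))) := by gcongr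
    _ = 2 * 10 ^ 4 * (2 ^ 40 + 2 * |(P.tpN : ℝ)| * 2 ^ 40 / (P.tpD : ℝ)) := by ring
    _ ≤ 2 * 10 ^ 4 * (2 ^ 40 + ((cdivZ (2 * |P.tpN| * D) P.tpD : ℤ) : ℝ)) := by gcongr

end Summit.HubbardSuperconductivity.HubbardSuperconductivity.Theorems.KlLindhardEnclosure

end
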